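import Summits.HodgeConjecture.HodgeConjecture.Theorems.Ring2AbelianAllStandardBUniformCorrespondences
import HarnessLib

/-!
# Ring 2 · sub-cell AbelianAll (ALL ABELIAN VARIETIES), André axis — ab-andre-1 part XV-b:
# KLEIMAN'S `B(X) ⟹ C(X)` ON THE REAL CARRIERS — André's degree-wise `B⋆(X, η)` makes every Künneth
# projector of `H•(X(ℂ); ℂ)` ONE algebraic class

HONEST FRAMING (page 1, verbatim): **research route, not a corollary; conditional on HC_CM plus one named
minimal statement.** Cell line: research route conditional on HC_CM; not a corollary; Q11.4-sentence-2
already refuted in dim ≥ 3. Nothing in this file proves an open case of the Hodge conjecture; the open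
standard conjecture `B⋆(X, η)` (`StandardConjectureBStar`, André 1996 §0.3 / Grothendieck 1968 `B(X)`) occurs
only as a HYPOTHESIS. Seat `pub-hodge-ring2-ab-andre-1`, gen 53.

## The statement (`exists_kunnethProjector_of_standardConjectureBStar`)

For `X` smooth projective over `ℂ` of dimension `n` with a polarisation class `η` satisfying the tree's DEGREE-WISE
`StandardConjectureBStar n X η` ("in every degree `⋆_L : Hᵃ → H^{2n−a}` is induced by SOME algebraic class", André
§0.3) and every `k`, there is ONE algebraic class `π_k ∈ Nⁿ H²ⁿ((X ⊗ X)(ℂ); ℂ)` with `[π_k]_* = id` on `Hᵏ(X(ℂ); ℂ)` and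
`[π_k]_* = 0` on `Hᵃ(X(ℂ); ℂ)` for every `a ≠ k` — Grothendieck's Künneth standard conjecture `C(X)` on the real
carriers (Kleiman 1968 §1.4 with §2 Prop. 2.3, "`B(X) ⟹ C(X)`"; Kleiman 1994 §4, Thm. 4-1 ff.). ab-andre-2's part XXII-f
(`exists_kunnethProjector_abelianVariety`) is the unconditional abelian-variety case via `[n]^* = nᵃ`; the present
file is the general conditional one and is the first input of the converse edges `(5∀) ⟹ Sq∀`, `(5) ⟹ Sq^CM` of
part XIV-g ("`B` stable under products", Kleiman 1968 Cor. 2.5), which need ONE class per operator.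

## Why a proof is needed at all (degree-wise versus graded `B`)

Kleiman's `B(X)` is about the graded operator `Λ` (or `⋆`) on all of `H•(X)`, one correspondence; the tree's
`StandardConjectureBStar` only gives, degree by degree, some algebraic class `S_a` acting as `⋆` on `Hᵃ` and
UNCONTROLLED on the other degrees, so Kleiman's one-line `πⁱ = polynomial in L, Λ` is not available. The proof
below is a two-sided "sandwich" induction on `j = 0, …, n` which never needs to know the junk: with
`lo_j = Σ_{a<j} π_a`, `hi_j = Σ_{a > 2n−j} π_a` already algebraic (ONE class each, acting as the indicated sums in
ALL degrees), and `S` some algebraic class acting as `⋆ : H^{2n−j} → Hʲ` (`r = n − j`),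
* `T  := S ∘ ([Δ] − hi_j)` acts `H^{b+2r} → Hᵇ` as `S` for `b ≤ j` and as `0` for `b > j` (§2 `exists_starCutoff`);
* `π_j := (T ∘ Lʳ) ∘ ([Δ] − lo_j)` — right twist then right cut-off — acts on `Hᵃ` as `[a = j] · id`, because
  `⋆ Lʳ = id` on `Hʲ` (`lefschetzInvolution_lefschetzPow`) and every other degree is cut off on one side (§3);
* `π_{2n−j} := Lʳ ∘ (([Δ] − lo_j) ∘ T)` — left cut-off then left twist — acts as `[a = 2n − j] · id`, because
  `Lʳ ⋆ = id` on `H^{2n−j}` (`lefschetzPow_lefschetzInvolution`); in the degrees `a < 2r`, where `T` has no target,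
  the left twist vanishes identically (§4, clause (ii) of `exists_leftTwist`);
all compositions / twists being the degree-UNIFORM ones of part XV-a (`exists_corrComp`, `exists_rightTwist`,
`exists_leftTwist`, `exists_diagonalClass`), so each `π` is ONE class with the stated action in EVERY degree.
§5 runs the induction (`kunneth_stage`) and §6 reads off `π_k` for `k ≤ n` from the lower and for `n < k ≤ 2n` from
the upper end (`k > 2n`: `π_k = 0`, the carrier being null).

## Relation to the Literature layer (count once; nothing restated)

`Literature.AlgebraicGeometry.Motives.standardConjectureC_of_standardConjectureB_holds`
(`StandardConjecturesKunnethProofs`) PROVES Kleiman's `B ⟹ C` for an abstract Weil cohomology theory `W` in the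
`θ`-form. There an operator "is algebraic" (`PreWeilCohomology.IsAlgebraicOperator`, `IsAlgebraicGradedOp`) when the
graded operator CONCENTRATED in its bidegree — zero components included — is induced by algebraic classes, so the junk
is excluded by the hypothesis itself and Kleiman's one-line `πⁱ = θⁱ ∘ Lⁿ⁻ⁱ` applies. The cell's `StandardConjectureBStar`
(André §0.3, on `H•(X(ℂ); ℂ)`, `Literature.AlgebraicGeometry.HodgeTheory.MotivatedClasses`) asks only for
`IsAlgebraicCorrespondence` of `⋆_L` one degree at a time — the formally WEAKER hypothesis shape — and the present file
shows that it still yields ONE class per Künneth projector, on the carriers the route files of this cell use. The two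
statements live on different cohomology interfaces (neither is a typed special case of the other); no Literature
statement is restated or re-proved here.

0 `def`, 0 named fact, 0 `sorry`. EDGE LABELS: all K (kernel) — `B⋆(X, η) ⟹ C(X)` on the carriers, for every smooth
projective complex `X`. References: Kleiman1968AlgebraicCycles (§1.4 (1.4.2–1.4.6), §2 Prop. 2.3, Cor. 2.5, App. 2A11);
Kleiman1994 (§4, Thm. 4-1 and the remarks following it); Grothendieck1968 (§3); Andre1996Motifs (§0.2–0.3, §1.1, Prop. 1.2, §2.1); Fulton1998 (§16.1);
VoisinHodgeII2003 (§9.2.4 Prop. 9.20); VoisinHodgeI2002 (Thm. 6.25).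
-/

noncomputable section

set_option linter.dupNamespace false

namespace Summit.HodgeConjecture.HodgeConjecture.Ring2.AbelianAll

open CategoryTheory AlgebraicGeometry MonoidalCategory CartesianMonoidalCategory
open Literature.AlgebraicGeometry Literature.AlgebraicGeometry.Motives
open Literature.AlgebraicGeometry.HodgeTheory
open Literature.AlgebraicTopology.SingularHomology (singularCohomology cupProduct)
open Literature.Geometry.Kaehler (lefschetzOperator lefschetzPow lefschetzPow_zero lefschetzPow_succ)

variable {n : ℕ} {X : SchemeOver ℂ}

/-! ## §1 Bookkeeping: cut-off classes `[Δ] − Σ π` and sums of indicator scalars -/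

/-- The action of `[Δ] − c` when `[Δ]_* = id` and `[c]_* = [P a] · id` on `Hᵃ`: `x ↦ 0` if `P a`, `x ↦ x` otherwise. [folklore] -/
theorem corrAction_sub_indicator_apply (hX : IsSmoothProjective n X) {δ c : complexBetti (X ⊗ X) (2 * n)}
    (Hδ : ∀ a : ℕ, corrAction complexOrientationFamily hX hX (rfl : a + 2 * n = a + 2 * n) δ = LinearMap.id)
    {P : ℕ → Prop} [DecidablePred P]
    (Hc : ∀ a : ℕ, corrAction complexOrientationFamily hX hX (rfl : a + 2 * n = a + 2 * n) c =
      (if P a then (1 : ℂ) else 0) • LinearMap.id)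
    (a : ℕ) (x : complexBetti X a) :
    corrAction complexOrientationFamily hX hX (rfl : a + 2 * n = a + 2 * n) (δ - c) x = if P a then 0 else x := by
  rw [map_sub, LinearMap.sub_apply, Hδ a, Hc a, LinearMap.smul_apply, LinearMap.id_apply]
  split_ifs <;> simp

/-- `[P] + [Q] = [R]` for exclusive `P, Q` with `R ↔ P ∨ Q`. [folklore] -/
theorem ite_add_ite_eq (P Q R : Prop) [Decidable P] [Decidable Q] [Decidable R] (hPQ : ¬ (P ∧ Q))
    (hR : R ↔ P ∨ Q) : ((if P then (1 : ℂ) else 0) + if Q then (1 : ℂ) else 0) = if R then (1 : ℂ) else 0 := by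
  by_cases hP : P <;> by_cases hQ : Q <;> simp_all

/-! ## §2 The cut-off `⋆`-class `T = S ∘ ([Δ] − hi)` -/

/-- **The cut-off `⋆`-class.** Let `j + r = n`, let `hi ∈ Nⁿ` be ONE algebraic class acting on `Hᵃ(X(ℂ))` as
`[2n < a + j] · id` for every `a`, and assume `B⋆(X, η)`. Then there is ONE algebraic `T ∈ Nʲ H^{2j}((X ⊗ X)(ℂ))`
(`T = S ∘ ([Δ] − hi)`, `S` any algebraic class acting as `⋆_L : H^{j+2r} → Hʲ`, André §0.3) with
(i) `[T]_*(Lʳ x) = x` for `x ∈ Hʲ`, (ii) `Lʳ([T]_* y) = y` for `y ∈ H^{j+2r}` (`⋆_L` inverts `Lʳ` there, André §1.1),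
(iii) `[T]_* = 0 : H^{b+2r} → Hᵇ` for every `b > j`. [cite: Andre1996Motifs, §0.2–0.3 (pp. 7–8) and §1.1 (p. 10)]
[cite: Kleiman1968AlgebraicCycles, §1.4 and §2 Prop. 2.3] [cite: Fulton1998, §16.1 Prop. 16.1.1] -/
theorem exists_starCutoff (hX : IsSmoothProjective n X) {η : complexBetti X 2} (hη : IsPolarizationClass n X η)
    (hB : StandardConjectureBStar n X η) {j r : ℕ} (hjr : j + r = n)
    {hi : complexBetti (X ⊗ X) (2 * n)} (hhi : hi ∈ algebraicClasses (X ⊗ X) n)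
    (Hhi : ∀ a : ℕ, corrAction complexOrientationFamily hX hX (rfl : a + 2 * n = a + 2 * n) hi =
      (if 2 * n < a + j then (1 : ℂ) else 0) • LinearMap.id) :
    ∃ T ∈ algebraicClasses (X ⊗ X) j,
      (∀ x : complexBetti X j, corrAction complexOrientationFamily hX hX
          (show j + 2 * r + 2 * j = j + 2 * n by omega) T (lefschetzPow η r j x) = x) ∧
      (∀ y : complexBetti X (j + 2 * r), lefschetzPow η r j (corrAction complexOrientationFamily hX hX
          (show j + 2 * r + 2 * j = j + 2 * n by omega) T y) = y) ∧
      (∀ {a b : ℕ} (hab : a + 2 * j = b + 2 * n), j < b → corrAction complexOrientationFamily hX hX hab T = 0) := by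
  have hL := hη.hasHardLefschetz
  -- `S`: some algebraic class acting as `⋆_L : H^{j+2r} → Hʲ` (degree-wise `B⋆`)
  obtain ⟨e, habS, S, hS, hSeq⟩ :=
    IsAlgebraicCorrespondence.exists_eq_corrAction hX hX (hB hη (j + 2 * r) j (by omega))
  have he : e = j := by omega
  subst e
  obtain ⟨δ, hδ, Hδ⟩ := exists_diagonalClass hX
  have hD : δ - hi ∈ algebraicClasses (X ⊗ X) n := Submodule.sub_mem _ hδ hhi
  have HD := corrAction_sub_indicator_apply hX Hδ Hhi
  obtain ⟨T, hT, HT⟩ := exists_corrComp complexOrientationFamily hX hX hX (show j + n = j + n from rfl) hS hD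
  refine ⟨T, hT, fun x ↦ ?_, fun y ↦ ?_, fun {a b} hab hjb ↦ ?_⟩
  · rw [HT rfl habS, LinearMap.comp_apply, HD, if_neg (by omega), ← hSeq]
    exact lefschetzInvolution_lefschetzPow hL hjr _ x
  · rw [HT rfl habS, LinearMap.comp_apply, HD, if_neg (by omega), ← hSeq]
    exact lefschetzPow_lefschetzInvolution hL hjr _ y
  · refine LinearMap.ext fun x ↦ ?_
    rw [HT rfl hab hab, LinearMap.comp_apply, HD, if_pos (by omega), map_zero, LinearMap.zero_apply]

/-! ## §3 The lower projector `π_j = (T ∘ Lʳ) ∘ ([Δ] − lo)` -/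

/-- **The Künneth projector `π_j`, `j ≤ n`, is ONE algebraic class**, granted `B⋆(X, η)` and ONE algebraic class each
for `lo = Σ_{a<j} π_a` and `hi = Σ_{a>2n−j} π_a`: `π_j = (T ∘ Lʳ_η) ∘ ([Δ] − lo)` acts on `Hᵃ(X(ℂ); ℂ)` as `[a = j] · id`
for EVERY `a`. [cite: Kleiman1968AlgebraicCycles, §1.4 and §2 Prop. 2.3] [cite: Andre1996Motifs, §1.1 (p. 10) and §2.1]
[cite: VoisinHodgeII2003, §9.2.4 Prop. 9.20 and proof of Thm. 10.17 (10.7)] -/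
theorem exists_kunnethProjector_lower (hX : IsSmoothProjective n X) {η : complexBetti X 2}
    (hη : IsPolarizationClass n X η) (hB : StandardConjectureBStar n X η) {j r : ℕ} (hjr : j + r = n)
    {lo : complexBetti (X ⊗ X) (2 * n)} (hlo : lo ∈ algebraicClasses (X ⊗ X) n)
    {hi : complexBetti (X ⊗ X) (2 * n)} (hhi : hi ∈ algebraicClasses (X ⊗ X) n)
    (Hlo : ∀ a : ℕ, corrAction complexOrientationFamily hX hX (rfl : a + 2 * n = a + 2 * n) lo =
      (if a < j then (1 : ℂ) else 0) • LinearMap.id)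
    (Hhi : ∀ a : ℕ, corrAction complexOrientationFamily hX hX (rfl : a + 2 * n = a + 2 * n) hi =
      (if 2 * n < a + j then (1 : ℂ) else 0) • LinearMap.id) :
    ∃ π ∈ algebraicClasses (X ⊗ X) n, ∀ a : ℕ,
      corrAction complexOrientationFamily hX hX (rfl : a + 2 * n = a + 2 * n) π =
        (if a = j then (1 : ℂ) else 0) • LinearMap.id := by
  obtain ⟨T, hT, hT₁, -, hT₀⟩ := exists_starCutoff hX hη hB hjr hhi Hhi
  -- right twist: `T' = T ∘ Lʳ`, ONE class of codimension `n`
  obtain ⟨T', hT', HT'⟩ :=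
    exists_rightTwist complexOrientationFamily hX hX hη.mem_algebraicClasses r (show j + r = n from hjr) hT
  obtain ⟨δ, hδ, Hδ⟩ := exists_diagonalClass hX
  have hE : δ - lo ∈ algebraicClasses (X ⊗ X) n := Submodule.sub_mem _ hδ hlo
  have HE := corrAction_sub_indicator_apply hX Hδ Hlo
  obtain ⟨π, hπ, Hπ⟩ := exists_corrComp complexOrientationFamily hX hX hX (show n + n = n + n from rfl) hT' hE
  refine ⟨π, hπ, fun a ↦ LinearMap.ext fun x ↦ ?_⟩
  rw [Hπ rfl rfl rfl, LinearMap.comp_apply, HE, LinearMap.smul_apply, LinearMap.id_apply]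
  rcases lt_trichotomy a j with haj | rfl | hja
  · rw [if_pos haj, map_zero, if_neg (by omega), zero_smul]
  · rw [if_neg (lt_irrefl _), if_pos rfl, one_smul,
      HT' (show a + 2 * r + 2 * a = a + 2 * n by omega) rfl x, hT₁ x]
  · rw [if_neg (by omega), if_neg (by omega), zero_smul,
      HT' (show a + 2 * r + 2 * j = a + 2 * n by omega) rfl x, hT₀ _ hja, LinearMap.zero_apply]

/-! ## §4 The upper projector `π_{j+2r} = Lʳ ∘ (([Δ] − lo) ∘ T)` -/

/-- **The Künneth projector `π_{2n−j} = π_{j+2r}`, `j + r = n`, is ONE algebraic class**, granted `B⋆(X, η)` and ONE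
algebraic class each for `lo`, `hi` as in §3: `π_{j+2r} = Lʳ_η ∘ (([Δ] − lo) ∘ T)` (a LEFT twist) acts on `Hᵃ(X(ℂ); ℂ)` as
`[a = j + 2r] · id` for EVERY `a` — in the degrees `a < 2r` because the left twist of a class with no target degree
vanishes. [cite: Kleiman1968AlgebraicCycles, §1.4 and §2 Prop. 2.3] [cite: Andre1996Motifs, §1.1 (p. 10) and §2.1]
[cite: FultonYoungTableaux1997, Appendix B §B.1 (3) and (6)] -/
theorem exists_kunnethProjector_upper (hX : IsSmoothProjective n X) {η : complexBetti X 2}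
    (hη : IsPolarizationClass n X η) (hB : StandardConjectureBStar n X η) {j r : ℕ} (hjr : j + r = n)
    {lo : complexBetti (X ⊗ X) (2 * n)} (hlo : lo ∈ algebraicClasses (X ⊗ X) n)
    {hi : complexBetti (X ⊗ X) (2 * n)} (hhi : hi ∈ algebraicClasses (X ⊗ X) n)
    (Hlo : ∀ a : ℕ, corrAction complexOrientationFamily hX hX (rfl : a + 2 * n = a + 2 * n) lo =
      (if a < j then (1 : ℂ) else 0) • LinearMap.id)
    (Hhi : ∀ a : ℕ, corrAction complexOrientationFamily hX hX (rfl : a + 2 * n = a + 2 * n) hi =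
      (if 2 * n < a + j then (1 : ℂ) else 0) • LinearMap.id) :
    ∃ π ∈ algebraicClasses (X ⊗ X) n, ∀ a : ℕ,
      corrAction complexOrientationFamily hX hX (rfl : a + 2 * n = a + 2 * n) π =
        (if a = j + 2 * r then (1 : ℂ) else 0) • LinearMap.id := by
  obtain ⟨T, hT, -, hT₂, hT₀⟩ := exists_starCutoff hX hη hB hjr hhi Hhi
  obtain ⟨δ, hδ, Hδ⟩ := exists_diagonalClass hX
  have hE : δ - lo ∈ algebraicClasses (X ⊗ X) n := Submodule.sub_mem _ hδ hlo
  have HE := corrAction_sub_indicator_apply hX Hδ Hlo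
  -- left cut-off: `U = ([Δ] − lo) ∘ T`, ONE class of codimension `j`
  obtain ⟨U, hU, HU⟩ := exists_corrComp complexOrientationFamily hX hX hX (show n + j = j + n by omega) hE hT
  -- left twist: `π' = Lʳ ∘ U`, ONE class of codimension `n`, vanishing on `Hᵃ` for `a < 2r`
  obtain ⟨π, hπ, H₁, H₀⟩ :=
    exists_leftTwist complexOrientationFamily hX hX hη.mem_algebraicClasses r (show j + r = n from hjr) hU
  refine ⟨π, hπ, fun a ↦ ?_⟩
  by_cases ha : a + 2 * j < 2 * n
  · rw [H₀ rfl ha, if_neg (by omega), zero_smul]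
  obtain ⟨b, rfl⟩ : ∃ b, a = b + 2 * r := ⟨a - 2 * r, by omega⟩
  refine LinearMap.ext fun x ↦ ?_
  rw [H₁ (show b + 2 * r + 2 * j = b + 2 * n by omega) rfl x,
    HU (show b + 2 * r + 2 * j = b + 2 * n by omega) rfl (show b + 2 * r + 2 * j = b + 2 * n by omega),
    LinearMap.comp_apply, HE, LinearMap.smul_apply, LinearMap.id_apply]
  rcases lt_trichotomy b j with hbj | rfl | hjb
  · rw [if_pos hbj, map_zero, if_neg (by omega), zero_smul]
  · rw [if_neg (lt_irrefl _), if_pos rfl, one_smul, hT₂ x]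
  · rw [if_neg (by omega), hT₀ _ hjb, LinearMap.zero_apply, map_zero, if_neg (by omega), zero_smul]

/-! ## §5 The sandwich induction -/

/-- **Stage `j ≤ n` of the induction**: granted `B⋆(X, η)`, there are ONE algebraic class `lo_j` acting on `Hᵃ(X(ℂ); ℂ)`
as `[a < j] · id` (= `Σ_{a<j} π_a`) and ONE algebraic class `hi_j` acting as `[2n < a + j] · id` (= `Σ_{a>2n−j} π_a`), for
every `a`. [cite: Kleiman1968AlgebraicCycles, §1.4 and §2 Prop. 2.3] [cite: Andre1996Motifs, §1.1 (p. 10) and §2.1] -/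
theorem kunneth_stage (hX : IsSmoothProjective n X) {η : complexBetti X 2} (hη : IsPolarizationClass n X η)
    (hB : StandardConjectureBStar n X η) :
    ∀ j : ℕ, j ≤ n → ∃ lo ∈ algebraicClasses (X ⊗ X) n, ∃ hi ∈ algebraicClasses (X ⊗ X) n,
      (∀ a : ℕ, corrAction complexOrientationFamily hX hX (rfl : a + 2 * n = a + 2 * n) lo =
        (if a < j then (1 : ℂ) else 0) • LinearMap.id) ∧
      (∀ a : ℕ, corrAction complexOrientationFamily hX hX (rfl : a + 2 * n = a + 2 * n) hi =
        (if 2 * n < a + j then (1 : ℂ) else 0) • LinearMap.id)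
  | 0, _ => by
    refine ⟨0, Submodule.zero_mem _, 0, Submodule.zero_mem _, fun a ↦ ?_, fun a ↦ ?_⟩
    · rw [map_zero, if_neg (Nat.not_lt_zero a), zero_smul]
    · by_cases ha : 2 * n < a + 0
      · haveI := subsingleton_complexBetti hX (show 2 * n < a by omega)
        exact LinearMap.ext fun x ↦ Subsingleton.elim _ _
      · rw [map_zero, if_neg ha, zero_smul]
  | j + 1, hj => by
    obtain ⟨lo, hlo, hi, hhi, Hlo, Hhi⟩ := kunneth_stage hX hη hB j (by omega)
    have hjr : j + (n - j) = n := by omega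
    obtain ⟨π, hπ, Hπ⟩ := exists_kunnethProjector_lower hX hη hB hjr hlo hhi Hlo Hhi
    obtain ⟨π', hπ', Hπ'⟩ := exists_kunnethProjector_upper hX hη hB hjr hlo hhi Hlo Hhi
    refine ⟨lo + π, Submodule.add_mem _ hlo hπ, hi + π', Submodule.add_mem _ hhi hπ', fun a ↦ ?_, fun a ↦ ?_⟩
    · rw [map_add, Hlo a, Hπ a, ← add_smul, ite_add_ite_eq (a < j) (a = j) (a < j + 1) (by omega) (by omega)]
    · rw [map_add, Hhi a, Hπ' a, ← add_smul,
        ite_add_ite_eq (2 * n < a + j) (a = j + 2 * (n - j)) (2 * n < a + (j + 1)) (by omega) (by omega)]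

/-! ## §6 `B⋆(X, η) ⟹ C(X)` on the real carriers -/

/-- **Kleiman's `B(X) ⟹ C(X)` on the real carriers, from André's degree-wise `B⋆`.** For `X` smooth projective over `ℂ`
of dimension `n`, a polarisation class `η` with `StandardConjectureBStar n X η`, and every `k`, there is ONE algebraic
class `π_k ∈ Nⁿ H²ⁿ((X ⊗ X)(ℂ); ℂ)` whose correspondence action on `Hᵃ(X(ℂ); ℂ)` is the identity for `a = k` and zero
for every other `a`: the Künneth components of the diagonal are algebraic (Grothendieck's `C(X)`; Kleiman 1968
§1.4 with §2 Prop. 2.3, Kleiman 1994 §4 Thm. 4-1 ff.; the abelian-variety case, unconditionally, is ab-andre-2's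
`exists_kunnethProjector_abelianVariety`). [cite: Kleiman1968AlgebraicCycles, §1.4, §2 Prop. 2.3 and App. 2A11]
[cite: Grothendieck1968, §3 p. 196] [cite: Andre1996Motifs, §0.2–0.3 (pp. 7–8), §1.1 and Prop. 1.2 (p. 11)] -/
theorem exists_kunnethProjector_of_standardConjectureBStar (hX : IsSmoothProjective n X) {η : complexBetti X 2}
    (hη : IsPolarizationClass n X η) (hB : StandardConjectureBStar n X η) (k : ℕ) :
    ∃ π ∈ algebraicClasses (X ⊗ X) n, ∀ a : ℕ,
      corrAction complexOrientationFamily hX hX (rfl : a + 2 * n = a + 2 * n) π =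
        (if a = k then (1 : ℂ) else 0) • LinearMap.id := by
  by_cases hk : k ≤ n
  · obtain ⟨lo, hlo, hi, hhi, Hlo, Hhi⟩ := kunneth_stage hX hη hB k hk
    exact exists_kunnethProjector_lower hX hη hB (show k + (n - k) = n by omega) hlo hhi Hlo Hhi
  by_cases hk₂ : k ≤ 2 * n
  · obtain ⟨lo, hlo, hi, hhi, Hlo, Hhi⟩ := kunneth_stage hX hη hB (2 * n - k) (by omega)
    obtain ⟨π, hπ, Hπ⟩ :=
      exists_kunnethProjector_upper hX hη hB (show 2 * n - k + (k - n) = n by omega) hlo hhi Hlo Hhi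
    refine ⟨π, hπ, fun a ↦ ?_⟩
    rw [Hπ a, show 2 * n - k + 2 * (k - n) = k by omega]
  · -- above the top degree the carrier is null
    refine ⟨0, Submodule.zero_mem _, fun a ↦ ?_⟩
    by_cases ha : a = k
    · haveI := subsingleton_complexBetti hX (show 2 * n < a by omega)
      exact LinearMap.ext fun x ↦ Subsingleton.elim _ _
    · rw [map_zero, if_neg ha, zero_smul]

/-- **Corollary — the complementary form used by Kleiman**: granted `B⋆(X, η)`, for every `k` ONE algebraic class acts
as `id` on `Hᵏ` and as `0` on every `Hᵃ`, `a ≠ k`; in particular `[Δ] − π_k` is ONE algebraic class killing exactly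
`Hᵏ`. Recorded in the `IsAlgebraicCorrespondence` currency of the route files: every operator
`(if a = k then c else 0) · id` on `Hᵃ(X(ℂ); ℂ)`, `c ∈ ℂ`, is an algebraic correspondence realised by the SAME class
`c · π_k` for all `a`. [cite: Kleiman1968AlgebraicCycles, §2 Prop. 2.3 and Cor. 2.5] [cite: Andre1996Motifs, §2.1 (p. 15)] -/
theorem exists_kunnethProjector_smul_of_standardConjectureBStar (hX : IsSmoothProjective n X)
    {η : complexBetti X 2} (hη : IsPolarizationClass n X η) (hB : StandardConjectureBStar n X η) (k : ℕ) (c : ℂ) :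
    ∃ π ∈ algebraicClasses (X ⊗ X) n, ∀ a : ℕ,
      corrAction complexOrientationFamily hX hX (rfl : a + 2 * n = a + 2 * n) π =
        (if a = k then c else 0) • LinearMap.id := by
  obtain ⟨π, hπ, Hπ⟩ := exists_kunnethProjector_of_standardConjectureBStar hX hη hB k
  refine ⟨c • π, Submodule.smul_mem _ c hπ, fun a ↦ ?_⟩
  rw [map_smul, Hπ a, smul_smul]
  congr 1
  split_ifs <;> simp

end Summit.HodgeConjecture.HodgeConjecture.Ring2.AbelianAll

end
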